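import Mathlib
import HarnessLib
import Literature.Analysis.Matrix.MotzkinWasow

/-!
# Soundness of the interval positive-definiteness certificate `pd_certify`
(pub-rhpf THEORY-4 §10 TABLE F, column "corner `N*` strictly positive definite";
mechanism/rigidity campaign — no RH claims)

PROVED (kernel) form of the LOGICAL SKELETON of engine A's certificate `pd_certify`
(python-flint / Arb; bundle `code/t4g5/job_t4g5F_r2/engA/wa_symeig.py`).  The certificate for a
real symmetric BALL matrix `𝐁` (midpoint `B`, entrywise radii `rad`) proceeds as follows: pick
`δ > 0`; let `R̃` be ANY real matrix (in practice an approximate Cholesky factor of `B − δI`);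
ENCLOSE the residual `E := R̃ᵀR̃ − (B − δI)` in ball arithmetic and bound its maximal absolute
row sum by `β`; bound the maximal row sum of `rad` by `ρ`; accept iff `δ − β − ρ > 0`.  The
theorems below say that acceptance implies: EVERY symmetric point matrix `B*` with
`|B* − B| ≤ rad` entrywise satisfies `xᵀB*x ≥ (δ − β − ρ)·xᵀx` for all `x`, hence is positive
definite (`λ_min(B*) ≥ δ − β − ρ > 0`).  (The implementation's extra term for the rounding of
the diagonal subtraction is absorbed here in `E`, which is defined from the EXACT `B − δI`.)

* `abs_quadForm_le_of_rowSum`   : Schur test / symmetric Gershgorin bound — if every absolute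
                                   row sum and every absolute column sum of `E` is `≤ β` then
                                   `|xᵀEx| ≤ β·xᵀx`;
* `colSum_le_of_transpose_eq`   : for symmetric `E` the column-sum bound is the row-sum bound;
* `quadForm_transpose_mul_self` : `xᵀ(RᵀR)x = (Rx)ᵀ(Rx) ≥ 0`;
* `residual_transpose`, `quadForm_residual` : the residual `E = RᵀR − (B − δI)` of a symmetric
                                   `B` is symmetric, and `xᵀEx = ‖Rx‖² − xᵀBx + δ·xᵀx`;
* `quadForm_ge_of_certificate`  : `xᵀBx ≥ (δ − β)·xᵀx` from the residual bound alone;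
* `quadForm_ge_of_certificate_ball` : `xᵀB*x ≥ (δ − β − ρ)·xᵀx` for every `B*` in the ball;
* `posDef_of_certificate_ball`  : `β + ρ < δ` ⇒ every symmetric `B*` in the ball is `PosDef`
                                   (`posDef_of_certificate`: the case `B* = B`, `ρ = 0`).

Pure real linear algebra ([folklore]: Rayleigh quotient; Schur test for a matrix with bounded
absolute row/column sums).  No DATA inside: which corners of which control pass the certificate,
with which `(δ, β, ρ)`, is DATA (TABLE F); the ball enclosures themselves are Arb's.  The
residual is written out as `Rᵀ * R - (B - δ • 1)` in every statement (no new definition).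
Decls in `…PfPersistence.PdCertify`.
-/

set_option linter.dupNamespace false  -- the mandated namespace repeats `RiemannHypothesis`

noncomputable section

open Matrix Finset

namespace Summit.RiemannHypothesis.RiemannHypothesis.Theorems.PfPersistence.PdCertify

variable {n k : Type*} [Fintype n] [Fintype k] [DecidableEq n]

omit [DecidableEq n] in
/-- PROVED: a nonzero real vector has `x ⬝ᵥ x > 0`. [folklore] -/
theorem dotProduct_self_pos_of_ne_zero {x : n → ℝ} (hx : x ≠ 0) : 0 < x ⬝ᵥ x := by
  obtain ⟨i, hi⟩ := Function.ne_iff.mp hx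
  have h1 : x i * x i ≤ ∑ j, x j * x j :=
    Finset.single_le_sum (f := fun j => x j * x j) (fun j _ => mul_self_nonneg (x j))
      (Finset.mem_univ i)
  have h2 : 0 < x i * x i := mul_self_pos.mpr hi
  have h3 : x ⬝ᵥ x = ∑ j, x j * x j := rfl
  rw [h3]
  exact lt_of_lt_of_le h2 h1

omit [DecidableEq n] in
/-- PROVED: the quadratic form written as a double sum. [folklore] -/
theorem quadForm_eq_sum_sum (E : Matrix n n ℝ) (x : n → ℝ) :
    x ⬝ᵥ (E *ᵥ x) = ∑ i, ∑ j, x i * (E i j * x j) := by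
  simp [dotProduct, mulVec, Finset.mul_sum]

omit [DecidableEq n] in
/-- PROVED (Schur test, entrywise form): if every absolute ROW sum and every absolute COLUMN sum
of a real matrix `E` is at most `β`, then `|Σᵢⱼ xᵢ Eᵢⱼ xⱼ| ≤ β · Σ xᵢ²`. [folklore] -/
theorem abs_sum_sum_le_of_rowSum_colSum (E : Matrix n n ℝ) {β : ℝ}
    (hr : ∀ i, ∑ j, |E i j| ≤ β) (hc : ∀ j, ∑ i, |E i j| ≤ β) (x : n → ℝ) :
    |∑ i, ∑ j, x i * (E i j * x j)| ≤ β * ∑ i, x i ^ 2 := by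
  have key : ∀ i j, |x i * (E i j * x j)| ≤ |E i j| * x i ^ 2 / 2 + |E i j| * x j ^ 2 / 2 := by
    intro i j
    rw [abs_mul, abs_mul]
    have hE : 0 ≤ |E i j| := abs_nonneg _
    nlinarith [mul_nonneg hE (sq_nonneg (|x i| - |x j|)), sq_abs (x i), sq_abs (x j),
      abs_nonneg (x i), abs_nonneg (x j)]
  have hA : ∑ i, ∑ j, |E i j| * x i ^ 2 ≤ β * ∑ i, x i ^ 2 := by
    calc ∑ i, ∑ j, |E i j| * x i ^ 2 = ∑ i, (∑ j, |E i j|) * x i ^ 2 := by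
            refine Finset.sum_congr rfl (fun i _ => ?_)
            rw [Finset.sum_mul]
      _ ≤ ∑ i, β * x i ^ 2 :=
            Finset.sum_le_sum (fun i _ => mul_le_mul_of_nonneg_right (hr i) (sq_nonneg _))
      _ = β * ∑ i, x i ^ 2 := by rw [Finset.mul_sum]
  have hB : ∑ i, ∑ j, |E i j| * x j ^ 2 ≤ β * ∑ i, x i ^ 2 := by
    calc ∑ i, ∑ j, |E i j| * x j ^ 2 = ∑ j, ∑ i, |E i j| * x j ^ 2 := Finset.sum_comm
      _ = ∑ j, (∑ i, |E i j|) * x j ^ 2 := by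
            refine Finset.sum_congr rfl (fun j _ => ?_)
            rw [Finset.sum_mul]
      _ ≤ ∑ j, β * x j ^ 2 :=
            Finset.sum_le_sum (fun j _ => mul_le_mul_of_nonneg_right (hc j) (sq_nonneg _))
      _ = β * ∑ i, x i ^ 2 := by rw [Finset.mul_sum]
  calc |∑ i, ∑ j, x i * (E i j * x j)|
      ≤ ∑ i, |∑ j, x i * (E i j * x j)| := Finset.abs_sum_le_sum_abs _ _
    _ ≤ ∑ i, ∑ j, |x i * (E i j * x j)| :=
          Finset.sum_le_sum (fun i _ => Finset.abs_sum_le_sum_abs _ _)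
    _ ≤ ∑ i, ∑ j, (|E i j| * x i ^ 2 / 2 + |E i j| * x j ^ 2 / 2) :=
          Finset.sum_le_sum (fun i _ => Finset.sum_le_sum (fun j _ => key i j))
    _ = (∑ i, ∑ j, |E i j| * x i ^ 2) / 2 + (∑ i, ∑ j, |E i j| * x j ^ 2) / 2 := by
          simp only [Finset.sum_add_distrib, Finset.sum_div]
    _ ≤ (β * ∑ i, x i ^ 2) / 2 + (β * ∑ i, x i ^ 2) / 2 := by linarith [hA, hB]
    _ = β * ∑ i, x i ^ 2 := by ring

omit [DecidableEq n] in
/-- PROVED (Schur test on the quadratic form): absolute row sums and column sums `≤ β` give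
`|xᵀEx| ≤ β · xᵀx`. [folklore] -/
theorem abs_quadForm_le_of_rowSum (E : Matrix n n ℝ) {β : ℝ}
    (hr : ∀ i, ∑ j, |E i j| ≤ β) (hc : ∀ j, ∑ i, |E i j| ≤ β) (x : n → ℝ) :
    |x ⬝ᵥ (E *ᵥ x)| ≤ β * (x ⬝ᵥ x) := by
  rw [quadForm_eq_sum_sum, Literature.Analysis.Matrix.MotzkinWasow.dotProduct_self_eq_sum_sq]
  exact abs_sum_sum_le_of_rowSum_colSum E hr hc x

omit [DecidableEq n] in
/-- PROVED: for a SYMMETRIC matrix the absolute column sums are the absolute row sums, so the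
row bound alone suffices. [folklore] -/
theorem colSum_le_of_transpose_eq (E : Matrix n n ℝ) (hE : Eᵀ = E) {β : ℝ}
    (hr : ∀ i, ∑ j, |E i j| ≤ β) : ∀ j, ∑ i, |E i j| ≤ β := by
  intro j
  have h : ∀ i, E i j = E j i := by
    intro i
    have := congrFun (congrFun hE j) i
    rw [transpose_apply] at this
    exact this
  calc ∑ i, |E i j| = ∑ i, |E j i| := Finset.sum_congr rfl (fun i _ => by rw [h i])
    _ ≤ β := hr j

omit [DecidableEq n] in
/-- PROVED: `xᵀ(RᵀR)x = (Rx)ᵀ(Rx)`. [folklore] -/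
theorem quadForm_transpose_mul_self (R : Matrix k n ℝ) (x : n → ℝ) :
    x ⬝ᵥ ((Rᵀ * R) *ᵥ x) = (R *ᵥ x) ⬝ᵥ (R *ᵥ x) := by
  rw [← mulVec_mulVec, dotProduct_mulVec, vecMul_transpose]

omit [DecidableEq n] in
/-- PROVED: `xᵀ(RᵀR)x ≥ 0`. [folklore] -/
theorem quadForm_transpose_mul_self_nonneg (R : Matrix k n ℝ) (x : n → ℝ) :
    0 ≤ x ⬝ᵥ ((Rᵀ * R) *ᵥ x) := by
  rw [quadForm_transpose_mul_self]
  exact Finset.sum_nonneg (fun i _ => mul_self_nonneg _)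

omit [Fintype n] in
/-- PROVED: the residual `RᵀR − (B − δI)` of a symmetric `B` is symmetric. [folklore] -/
theorem residual_transpose (B : Matrix n n ℝ) (hB : Bᵀ = B) (R : Matrix k n ℝ) (δ : ℝ) :
    (Rᵀ * R - (B - δ • (1 : Matrix n n ℝ)))ᵀ = Rᵀ * R - (B - δ • (1 : Matrix n n ℝ)) := by
  rw [transpose_sub, transpose_sub, transpose_mul, transpose_transpose, transpose_smul,
    transpose_one, hB]

/-- PROVED: the quadratic form of the residual. [folklore] -/
theorem quadForm_residual (B : Matrix n n ℝ) (R : Matrix k n ℝ) (δ : ℝ) (x : n → ℝ) :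
    x ⬝ᵥ ((Rᵀ * R - (B - δ • (1 : Matrix n n ℝ))) *ᵥ x)
      = (R *ᵥ x) ⬝ᵥ (R *ᵥ x) - (x ⬝ᵥ (B *ᵥ x) - δ * (x ⬝ᵥ x)) := by
  rw [sub_mulVec, sub_mulVec, smul_mulVec, one_mulVec, dotProduct_sub, dotProduct_sub,
    dotProduct_smul, smul_eq_mul, quadForm_transpose_mul_self]

/-- PROVED (certificate, POINT form): if the residual `E = RᵀR − (B − δI)` of SOME trial factor
`R` has all absolute row and column sums `≤ β`, then `xᵀBx ≥ (δ − β)·xᵀx` for every `x`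
(i.e. `λ_min(B) ≥ δ − β`). [folklore] -/
theorem quadForm_ge_of_certificate (B : Matrix n n ℝ) (R : Matrix k n ℝ) (δ β : ℝ)
    (hr : ∀ i, ∑ j, |(Rᵀ * R - (B - δ • (1 : Matrix n n ℝ))) i j| ≤ β)
    (hc : ∀ j, ∑ i, |(Rᵀ * R - (B - δ • (1 : Matrix n n ℝ))) i j| ≤ β)
    (x : n → ℝ) : (δ - β) * (x ⬝ᵥ x) ≤ x ⬝ᵥ (B *ᵥ x) := by
  have h1 := abs_quadForm_le_of_rowSum (Rᵀ * R - (B - δ • (1 : Matrix n n ℝ))) hr hc x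
  have h2 := quadForm_residual B R δ x
  have h3 : 0 ≤ (R *ᵥ x) ⬝ᵥ (R *ᵥ x) := Finset.sum_nonneg (fun i _ => mul_self_nonneg _)
  have h4 := (abs_le.mp h1).2
  rw [h2] at h4
  nlinarith [h3, h4]

/-- PROVED (certificate, BALL form): if in addition `B*` is entrywise within a perturbation
`B* − B` whose absolute row and column sums are `≤ ρ`, then `xᵀB*x ≥ (δ − β − ρ)·xᵀx` for
every `x` (i.e. `λ_min(B*) ≥ δ − β − ρ`). [folklore] -/
theorem quadForm_ge_of_certificate_ball (Bs B : Matrix n n ℝ) (R : Matrix k n ℝ) (δ β ρ : ℝ)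
    (hr : ∀ i, ∑ j, |(Rᵀ * R - (B - δ • (1 : Matrix n n ℝ))) i j| ≤ β)
    (hc : ∀ j, ∑ i, |(Rᵀ * R - (B - δ • (1 : Matrix n n ℝ))) i j| ≤ β)
    (hρr : ∀ i, ∑ j, |(Bs - B) i j| ≤ ρ) (hρc : ∀ j, ∑ i, |(Bs - B) i j| ≤ ρ)
    (x : n → ℝ) : (δ - β - ρ) * (x ⬝ᵥ x) ≤ x ⬝ᵥ (Bs *ᵥ x) := by
  have h1 := quadForm_ge_of_certificate B R δ β hr hc x
  have h2 := abs_quadForm_le_of_rowSum (Bs - B) hρr hρc x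
  have h3 : x ⬝ᵥ ((Bs - B) *ᵥ x) = x ⬝ᵥ (Bs *ᵥ x) - x ⬝ᵥ (B *ᵥ x) := by
    rw [sub_mulVec, dotProduct_sub]
  have h4 := (abs_le.mp h2).1
  rw [h3] at h4
  nlinarith [h1, h4]

omit [Fintype n] [DecidableEq n] in
/-- PROVED: a real symmetric matrix is Hermitian. [folklore] -/
theorem isHermitian_of_transpose_eq (B : Matrix n n ℝ) (hB : Bᵀ = B) : B.IsHermitian := by
  unfold Matrix.IsHermitian
  rw [conjTranspose_eq_transpose_of_trivial]
  exact hB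

/-- PROVED (soundness of `pd_certify`, BALL form): let `B` (the midpoint) and `B*` (any point
matrix of the ball) be real SYMMETRIC; let `R` be any trial factor and `E = RᵀR − (B − δI)` its
residual with absolute row sums `≤ β`; let the perturbation `B* − B` have absolute row sums
`≤ ρ`; if `β + ρ < δ` then `B*` is POSITIVE DEFINITE.  (Column-sum bounds follow from symmetry,
`colSum_le_of_transpose_eq`.) [folklore] -/
theorem posDef_of_certificate_ball (Bs B : Matrix n n ℝ) (hBs : Bsᵀ = Bs) (hB : Bᵀ = B)
    (R : Matrix k n ℝ) (δ β ρ : ℝ)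
    (hr : ∀ i, ∑ j, |(Rᵀ * R - (B - δ • (1 : Matrix n n ℝ))) i j| ≤ β)
    (hρr : ∀ i, ∑ j, |(Bs - B) i j| ≤ ρ)
    (hmargin : β + ρ < δ) : Bs.PosDef := by
  have hc := colSum_le_of_transpose_eq (Rᵀ * R - (B - δ • (1 : Matrix n n ℝ)))
    (residual_transpose B hB R δ) hr
  have hDt : (Bs - B)ᵀ = Bs - B := by rw [transpose_sub, hBs, hB]
  have hρc := colSum_le_of_transpose_eq (Bs - B) hDt hρr
  refine Matrix.PosDef.of_dotProduct_mulVec_pos (isHermitian_of_transpose_eq Bs hBs) ?_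
  intro x hx
  rw [star_trivial]
  have h1 := quadForm_ge_of_certificate_ball Bs B R δ β ρ hr hc hρr hρc x
  have h2 : 0 < (δ - β - ρ) * (x ⬝ᵥ x) :=
    mul_pos (by linarith) (dotProduct_self_pos_of_ne_zero hx)
  exact lt_of_lt_of_le h2 h1

/-- PROVED (soundness of `pd_certify`, POINT form): a real symmetric `B` whose residual
`E = RᵀR − (B − δI)` (any trial `R`) has absolute row sums `≤ β < δ` is positive definite.
[folklore] -/
theorem posDef_of_certificate (B : Matrix n n ℝ) (hB : Bᵀ = B) (R : Matrix k n ℝ) (δ β : ℝ)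
    (hr : ∀ i, ∑ j, |(Rᵀ * R - (B - δ • (1 : Matrix n n ℝ))) i j| ≤ β) (hmargin : β < δ) :
    B.PosDef := by
  refine posDef_of_certificate_ball B B hB hB R δ β 0 hr ?_ (by linarith)
  intro i
  simp

end Summit.RiemannHypothesis.RiemannHypothesis.Theorems.PfPersistence.PdCertify

end
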